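import Summits.QuantumFields.BalabanUV.T4Continuum.Support.NE7SliceIterationStep
import Summits.QuantumFields.BalabanUV.T4Continuum.Support.NE7SliceIterationContractionArith
import Summits.QuantumFields.BalabanUV.T4Continuum.Support.NE7DefectIterationCauchy
import HarnessLib

/-!
# NE7SliceIterationOrbit — THE (S1) ITERATION CONVERGES (memo ROAD-G100 §2.7 item F4, fifth file): on the working region the step `u ↦ e^{−ζ(u)}u` keeps the region, HALVES THE DEFECT, moves the sizes
# by `≤ 300dM·Df` and each site by `≤ 12dM·Df`; the Cauchy engine `NE7DefectIterationCauchy.exists_orbit_limit` then gives a unitary periodic sitewise limit `u⋆` of the orbit of `u₀` with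
# `Df(u_j) ≤ 2^{−j}δ₀`, `‖u_j(y) − u⋆(y)‖ ≤ 24dM·δ₀·2^{−j}` and the sizes bounded by `s₀ + 600dM·δ₀` along the orbit

Cell `pub-balaban`, rung (B)+1 sub-cell t4, lineage `b2b-balaban-t4-ne7-p1`, generation 101 (CRUX PROVER NE7 #1 = OWNER of BINDER row NE7).  Memo `t4/b2b-balaban-t4-ne7-p1-g101/ROAD-G101.md` §10.
STATE SET `K := {u | unitary ∧ (tower)-periodic ∧ chart (U′^{u} = W e^{X(u)}) ∧ corners (u(M•z) = e^{h(u)z}) ∧ Df(u) ≤ δmax}`, size `Φ := sizePair` (`(sup‖X(u)‖, sup‖h(u)‖) ∈ ℝ×ℝ`), defect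
`Df := sliceDefect`, step `sliceStep`; regime: a single smallness parameter `τ` with `M·S, S, M·δmax, M²x, M²x′ ≤ τ`, `30000dτ ≤ 1`, `6dM·δmax ≤ 10⁻⁴`, `S ≤ 10⁻⁴` and
`3·10⁶(1+16K)(1+d)³(1+frameC)(1+supC+supCurlC)·τ ≤ 1∕2` (`K` the curved sup letter constant, displayed as `hLet`).
WHAT ([folklore]; 0 def, 0 sorry).  §1 `region_sizes` (pointwise sizes from `‖sizePair u‖ ≤ S`), **`step_halves_defect`** (`Df(e^{−ζ(u)}u) ≤ Df(u)∕2`: `sliceDefect_sliceStep_le` + the floors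
`eE_le`∕`twoKM_cE_le`∕`ecM_le` + `step_bound_le_half`), `step_sizes_le` (`‖sizePair(e^{−ζ(u)}u)‖ ≤ ‖sizePair u‖ + 300dM·Df(u)`).  §2 **`slice_orbit`** (statement displayed).
HONEST FRAMING (page 1): the engine run on OUR state maps; the limit's slice condition (`T(u⋆) ∈ 𝒯_E`, F4d-iii) and the junction (F4e) are NOT here; nothing of Bałaban's asserted; NOT (S1) in full,
NOT NE7; spine 0∕9; finite T⁴ rung (B)+1 — NOT infinite volume, NOT mass gap, NOT BetaPertH, NOT Clay.  Continuum YM on T⁴ ⇐ BetaPertH ∧ nine spine estimates (0/9 proved); BetaPertH ⇐ (D1) ∧ (D4) ∧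
CAP+tail; G-an2-4 gates asym, D1 and NE2/3/4.
-/

set_option autoImplicit false

open scoped BigOperators Matrix.Norms.L2Operator
open NormedSpace Finset Filter Topology

namespace Summit.QuantumFields.BalabanUV.T4Continuum.NE7SliceIterationOrbit

open Literature.MathematicalPhysics.QuantumFieldTheory.Balaban1983to89
open B7Prop1Explicit B7Prop2Explicit MatrixLog
open T4AveragingDeficitWall (IsUnitaryCfg IsSkewDir SmallField vary curlAt)
open T4AveragingDeficitWallBoundary (IsPeriodicCfg periodBox)
open AveragingDeficitPeriodicCounting (IsPeriodicDir)
open AveragingDeficitTwoLevelPrep (prop1Radius)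
open AveragingDeficitMultiLevelPrep (cavgIter LevelSmall tower)
open BlockAveragePushDirGauge (gaugeDir)
open NE3EnergyShapes (IsUnitarySite IsPeriodicSite)
open NE3RightInverseSupLetters (frameC supC)
open NE3HatInvCurlLetters (supCurlC)
open NE3QbarIterCovLiftPrep (cruxC)
open NE3LinearisedAverageSup (curvSum)
open NE7MeanZeroGaugeSliceW (energyBlockLandauW)
open NE7DefectIterationCauchy (exists_orbit_limit mem_unitary_of_tendsto periodic_of_tendsto)
open SpreadLift (loopRad)
open NE7SliceIterationState
open NE7SliceIterationStateFacts
open NE7SliceIterationStep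
open NE7SliceIterationContractionArith

noncomputable section

variable {d : ℕ} {n : Type*} [Fintype n] [DecidableEq n]

section Orbit

variable [Nonempty n] {L : ℕ} (hL : 2 ≤ L) (k : ℕ) {W : Site d → Fin d → (Matrix n n ℂ)ˣ} {x : ℝ} (hWu : IsUnitaryCfg W) (hx : 0 ≤ x) (hs : LevelSmall d L k x)
  (hWx : SmallField W x) (N : ℕ) [NeZero N] (hθ : cruxC d L * (((L : ℝ) ^ (k + 1)) ^ 2 * x) < 1) (U' : Site d → Fin d → (Matrix n n ℂ)ˣ)
  (hWP : IsPeriodicCfg W ((tower L N (k + 1) : ℕ) : ℤ)) (hU'u : IsUnitaryCfg U') (hU'P : IsPeriodicCfg U' ((tower L N (k + 1) : ℕ) : ℤ))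

/-! ## §1 Pointwise sizes on the region; the step halves the defect and moves the sizes little -/

omit [Nonempty n] in
include hL hWP hU'P in
/-- **POINTWISE SIZES FROM THE SIZE PAIR**: for a `(tower)`-periodic `u`, `‖X(u) y κ‖ ≤ (sizePair u).1 ≤ ‖sizePair u‖` and `‖h(u) z‖ ≤ (sizePair u).2 ≤ ‖sizePair u‖`, both components `≥ 0`. [folklore] -/
theorem region_sizes {u : Site d → (Matrix n n ℂ)ˣ} (huP : IsPeriodicSite u ((tower L N (k + 1) : ℕ) : ℤ)) :
    (∀ y κ, ‖repLog W U' u y κ‖ ≤ (sizePair (L := L) (W := W) k N U' u).1) ∧ (∀ z, ‖cornerLog L k u z‖ ≤ (sizePair (L := L) (W := W) k N U' u).2) ∧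
      0 ≤ (sizePair (L := L) (W := W) k N U' u).1 ∧ (sizePair (L := L) (W := W) k N U' u).1 ≤ ‖sizePair (L := L) (W := W) k N U' u‖ ∧
      0 ≤ (sizePair (L := L) (W := W) k N U' u).2 ∧ (sizePair (L := L) (W := W) k N U' u).2 ≤ ‖sizePair (L := L) (W := W) k N U' u‖ := by
  haveI : NeZero L := ⟨by omega⟩
  have hP1 : 1 ≤ tower L N (k + 1) := Nat.one_le_iff_ne_zero.mpr (NeZero.ne _)
  have hN1 : 1 ≤ N := Nat.one_le_iff_ne_zero.mpr (NeZero.ne _)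
  have hXP := repLog_periodic k N U' hWP hU'P huP
  have h1 : ∀ y κ, ‖repLog W U' u y κ‖ ≤ (sizePair (L := L) (W := W) k N U' u).1 := fun y κ =>
    le_bondSup hP1 (F := fun y μ => ‖repLog W U' u y μ‖) (fun x κ μ => by simp only [hXP x κ μ]) y κ
  have h2 : ∀ z, ‖cornerLog L k u z‖ ≤ (sizePair (L := L) (W := W) k N U' u).2 := fun z =>
    le_siteSup hN1 (f := fun z => ‖cornerLog L k u z‖) (fun x κ => by simp only [cornerLog_periodic k N huP x κ]) z
  have h10 : 0 ≤ (sizePair (L := L) (W := W) k N U' u).1 := bondSup_nonneg fun y μ => norm_nonneg _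
  have h20 : 0 ≤ (sizePair (L := L) (W := W) k N U' u).2 := siteSup_nonneg fun z => norm_nonneg _
  refine ⟨h1, h2, h10, ?_, h20, ?_⟩
  · have := norm_fst_le (sizePair (L := L) (W := W) k N U' u); rwa [Real.norm_of_nonneg h10] at this
  · have := norm_snd_le (sizePair (L := L) (W := W) k N U' u); rwa [Real.norm_of_nonneg h20] at this

include hWP hU'u hU'P in
/-- **THE STEP HALVES THE DEFECT** on the region `‖sizePair u‖ ≤ S`, `Df(u) ≤ δmax` in the regime of the header. [folklore] -/
theorem step_halves_defect (hd : 0 < d)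
    (hθP : 4 * (d : ℝ) ^ 2 * ((L : ℝ) ^ (k + 1) - 1) ^ 2 * x + 16 * d * loopRad d L ((prop1Radius d L)^[k] x)
      + 4 * d * ((d : ℝ) - 1) * ((L : ℝ) ^ (k + 1) - 1) ^ 2 * x ≤ 1 / 2)
    {K : ℝ} (hK : 0 ≤ K) (hKε : 16 * K * d * (((L : ℝ) ^ (k + 1)) ^ 2 * x) ≤ 1 / 2)
    (hLet : ∀ Y : Site d → Fin d → Matrix n n ℂ, Y ∈ energyBlockLandauW (d := d) (n := n) L N (k + 1) W →
      ∀ B : ℝ, (∀ (z : Site d) (μ ν : Fin d), μ ≠ ν → ‖curlAt W Y z μ ν‖ ≤ B) → ∀ (y : Site d) (κ : Fin d), ‖Y y κ‖ ≤ K * (L : ℝ) ^ (k + 1) * B)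
    (hε : ((L : ℝ) ^ (k + 1)) ^ 2 * x ≤ 1) (hA : curvSum d L (k + 1) x ≤ 2 / 3 * L) (hθc : cruxC d L * (((L : ℝ) ^ (k + 1)) ^ 2 * x) ≤ 1 / 2)
    {x' : ℝ} (hx'0 : 0 ≤ x') (hU'x : SmallField U' x')
    {τ S δmax : ℝ} (hτ0 : 0 ≤ τ) (hτ1 : τ ≤ 1) (hτs : 30000 * (d : ℝ) * τ ≤ 1)
    (hC : 3000000 * (1 + 16 * K) * (1 + (d : ℝ)) ^ 3 * (1 + frameC d L) * (1 + supC d L + supCurlC d L) * τ ≤ 1 / 2)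
    (hS0 : 0 ≤ S) (hS4 : S ≤ 1 / 10000) (hMS : (L : ℝ) ^ (k + 1) * S ≤ τ) (hSτ : S ≤ τ)
    (hδmax : 6 * (d : ℝ) * (L : ℝ) ^ (k + 1) * δmax ≤ 1 / 10000) (hMδ : (L : ℝ) ^ (k + 1) * δmax ≤ τ)
    (h4 : ((L : ℝ) ^ (k + 1)) ^ 2 * x ≤ τ) (h5 : ((L : ℝ) ^ (k + 1)) ^ 2 * x' ≤ τ)
    {u : Site d → (Matrix n n ℂ)ˣ} (hu : IsUnitarySite u) (huP : IsPeriodicSite u ((tower L N (k + 1) : ℕ) : ℤ))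
    (hgauge : gaugeAct u U' = vary W (repLog W U' u) 1)
    (hcorner : ∀ z, ((u (((L : ℤ) ^ (k + 1)) • z) : (Matrix n n ℂ)ˣ) : Matrix n n ℂ) = exp (cornerLog L k u z))
    (hDf : sliceDefect hL k hWu hx hs hWx N hθ U' u ≤ δmax) (hΦ : ‖sizePair (L := L) (W := W) k N U' u‖ ≤ S) :
    sliceDefect hL k hWu hx hs hWx N hθ U' (sliceStep hL k hWu hx hs hWx N hθ U' u) ≤ sliceDefect hL k hWu hx hs hWx N hθ U' u / 2 := by
  have hM1 : (1 : ℝ) ≤ (L : ℝ) ^ (k + 1) := one_le_pow₀ (by exact_mod_cast (by omega : 1 ≤ L))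
  have hd1 : (1 : ℝ) ≤ d := by exact_mod_cast hd
  obtain ⟨hX, hh, h10, h1le, h20, h2le⟩ := region_sizes hL k N U' hWP hU'P huP
  have hXs : ∀ y κ, ‖repLog W U' u y κ‖ ≤ S := fun y κ => (hX y κ).trans (h1le.trans hΦ)
  have hhs : ∀ z, ‖cornerLog L k u z‖ ≤ S := fun z => (hh z).trans (h2le.trans hΦ)
  have hS2 : S ≤ 1 / 100 := hS4.trans (by norm_num)
  have hX8 : ∀ y κ, ‖repLog W U' u y κ‖ ≤ 1 / 8 := fun y κ => (hXs y κ).trans (by linarith)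
  have hh8 : ∀ z, ‖cornerLog L k u z‖ ≤ 1 / 8 := fun z => (hhs z).trans (by linarith)
  clear hX hh h10 h1le h20 h2le hΦ
  have hDf0 : 0 ≤ sliceDefect hL k hWu hx hs hWx N hθ U' u := sliceDefect_nonneg hL k hWu hx hs hWx N hθ U' u
  -- make the defect an opaque real
  obtain ⟨D, hDdef⟩ : ∃ D : ℝ, sliceDefect hL k hWu hx hs hWx N hθ U' u = D := ⟨_, rfl⟩
  have hD0 : 0 ≤ D := hDdef ▸ hDf0
  have hDmax : D ≤ δmax := hDdef ▸ hDf
  clear hDf hDf0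
  have hM0 : 0 < (L : ℝ) ^ (k + 1) := by positivity
  have hδ : ∀ y μ, ‖gaugeDir W (gaugeFun hL k hWu hx hs hWx N hθ U' u) y μ‖ ≤ D := fun y μ =>
    hDdef ▸ ((norm_gaugeDir_gaugeFun_le hL k hWu hx hs hWx N hθ U' hWP hU'u hU'P hu huP hgauge hX8 hcorner hh8 y μ).trans
      (delta_le_sliceDefect hL k hWu hx hs hWx N hθ U' u))
  have hσ : ∀ y, ‖gaugeFun hL k hWu hx hs hWx N hθ U' u y‖ ≤ 6 * d * (L : ℝ) ^ (k + 1) * D := fun y => by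
    rw [← hDdef]; exact norm_gaugeFun_le hL k hWu hx hs hWx N hθ U' hWP hU'u hU'P hu huP hgauge hX8 hcorner hh8 hd hθP y
  have hσ0 : 0 ≤ 6 * (d : ℝ) * (L : ℝ) ^ (k + 1) * D := by positivity
  have hσ4 : 6 * (d : ℝ) * (L : ℝ) ^ (k + 1) * D ≤ 1 / 10000 := (mul_le_mul_of_nonneg_left hDmax (by positivity)).trans hδmax
  have hδ4 : D ≤ 1 / 10000 := by
    have h1 : D ≤ 6 * (d : ℝ) * (L : ℝ) ^ (k + 1) * D := by
      have : (1 : ℝ) ≤ 6 * (d : ℝ) * (L : ℝ) ^ (k + 1) := by nlinarith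
      exact le_mul_of_one_le_left hD0 this
    exact h1.trans hσ4
  -- the letters as nonnegative reals
  have hfC : 0 ≤ frameC d L := by unfold frameC; positivity
  have hsC : 0 ≤ supC d L := by
    unfold supC NE3RightInverseSupLetters.corrC NE3RightInverseSupLetters.frameC; have := NE3QbarIterCovLiftPrep.liftC_nonneg d; positivity
  have hsCC : 0 ≤ supCurlC d L := by
    unfold supCurlC NE3RightInverseSupLetters.frameC; have := NE3QbarIterCovLiftPrep.liftC_nonneg d; positivity
  have h1θ : 0 < 1 - cruxC d L * (((L : ℝ) ^ (k + 1)) ^ 2 * x) := by linarith only [hθc]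
  have heJ0 : 0 ≤ 16384 * D * S + 2048 * (6 * (d : ℝ) * (L : ℝ) ^ (k + 1) * D) * D + 6 * (6 * (d : ℝ) * (L : ℝ) ^ (k + 1) * D) * S := by positivity
  have hec0 : 0 ≤ 4096 * (6 * (d : ℝ) * (L : ℝ) ^ (k + 1) * D) * S := by positivity
  have hφ0 : 0 ≤ (3 + 12 * (d : ℝ)) * (L : ℝ) ^ (k + 1) * (16384 * D * S + 2048 * (6 * (d : ℝ) * (L : ℝ) ^ (k + 1) * D) * D + 6 * (6 * (d : ℝ) * (L : ℝ) ^ (k + 1) * D) * S)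
      + 2 * (4096 * (6 * (d : ℝ) * (L : ℝ) ^ (k + 1) * D) * S) := by
    positivity
  have heE0 : 0 ≤ (16384 * D * S + 2048 * (6 * (d : ℝ) * (L : ℝ) ^ (k + 1) * D) * D + 6 * (6 * (d : ℝ) * (L : ℝ) ^ (k + 1) * D) * S)
      + supC d L / ((L : ℝ) ^ (k + 1) * (1 - cruxC d L * (((L : ℝ) ^ (k + 1)) ^ 2 * x)))
        * ((3 + 12 * (d : ℝ)) * (L : ℝ) ^ (k + 1) * (16384 * D * S + 2048 * (6 * (d : ℝ) * (L : ℝ) ^ (k + 1) * D) * D + 6 * (6 * (d : ℝ) * (L : ℝ) ^ (k + 1) * D) * S)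
          + 2 * (4096 * (6 * (d : ℝ) * (L : ℝ) ^ (k + 1) * D) * S)) :=
    add_nonneg heJ0 (mul_nonneg (div_nonneg hsC (mul_pos hM0 h1θ).le) hφ0)
  have hexp0 : 0 ≤ Real.exp (4 * (S + D + (16384 * D * S + 2048 * (6 * (d : ℝ) * (L : ℝ) ^ (k + 1) * D) * D + 6 * (6 * (d : ℝ) * (L : ℝ) ^ (k + 1) * D) * S))) - 1 := by
    have := Real.add_one_le_exp (4 * (S + D + (16384 * D * S + 2048 * (6 * (d : ℝ) * (L : ℝ) ^ (k + 1) * D) * D + 6 * (6 * (d : ℝ) * (L : ℝ) ^ (k + 1) * D) * S)))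
    linarith only [this, heJ0, hS0, hD0]
  have hcE0 : 0 ≤ (2 * (2 * (6 * (d : ℝ) * (L : ℝ) ^ (k + 1) * D)) * x'
        + 4 * (Real.exp (4 * (S + D + (16384 * D * S + 2048 * (6 * (d : ℝ) * (L : ℝ) ^ (k + 1) * D) * D + 6 * (6 * (d : ℝ) * (L : ℝ) ^ (k + 1) * D) * S))) - 1)
          * (D + (16384 * D * S + 2048 * (6 * (d : ℝ) * (L : ℝ) ^ (k + 1) * D) * D + 6 * (6 * (d : ℝ) * (L : ℝ) ^ (k + 1) * D) * S))
        + 2 * x * (6 * (d : ℝ) * (L : ℝ) ^ (k + 1) * D))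
      + supCurlC d L / (((L : ℝ) ^ (k + 1)) ^ 2 * (1 - cruxC d L * (((L : ℝ) ^ (k + 1)) ^ 2 * x)))
        * ((3 + 12 * (d : ℝ)) * (L : ℝ) ^ (k + 1) * (16384 * D * S + 2048 * (6 * (d : ℝ) * (L : ℝ) ^ (k + 1) * D) * D + 6 * (6 * (d : ℝ) * (L : ℝ) ^ (k + 1) * D) * S)
          + 2 * (4096 * (6 * (d : ℝ) * (L : ℝ) ^ (k + 1) * D) * S)) := by
    refine add_nonneg (add_nonneg (add_nonneg (by positivity) (mul_nonneg (mul_nonneg (by norm_num) hexp0) (add_nonneg hD0 heJ0))) (by positivity))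
      (mul_nonneg (div_nonneg hsCC (mul_pos (by positivity) h1θ).le) hφ0)
  have hstep := sliceDefect_sliceStep_le hL k hWu hx hs hWx N hθ U' hWP hU'u hU'P hu huP hgauge hcorner hXs hS4 hhs hS2 hδ hσ hσ4 hd hθP hK hKε hLet hε hA hU'x
    hS0 hS0 hD0 hδ4 hσ0 heE0 hcE0 le_rfl le_rfl
  rw [hDdef]
  refine hstep.trans ?_
  -- the arithmetic, with `M = L^{k+1}` opaque
  obtain ⟨M, hMdef⟩ : ∃ M : ℝ, (L : ℝ) ^ (k + 1) = M := ⟨_, rfl⟩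
  rw [hMdef] at hM1 hMS hδmax hMδ h4 h5 heE0 hec0 hM0 ⊢
  have hθcM : cruxC d L * (M ^ 2 * x) ≤ 1 / 2 := by rw [← hMdef]; exact hθc
  have h2 : M * D ≤ τ := (mul_le_mul_of_nonneg_left hDmax hM0.le).trans hMδ
  have heEb := eE_le (sC := supC d L) hd1 hM1 hsC hS0 hS0 hD0 hθcM hτ0 hMS h2 hSτ
  have hcEb := twoKM_cE_le (sCC := supCurlC d L) hd1 hM1 hK hsCC hS0 hS0 hD0 hθcM hτ0 hMS h2 hSτ h4 h5 hτs
  have hecb := ecM_le hd1 hM1 hD0 hSτ (η := S) (D := D)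
  exact step_bound_le_half hd1 hM1 hK hfC hsC hsCC hD0 hx hτ0 hτ1 h4 heE0 hec0 heEb hcEb hecb hC

include hWP hU'u hU'P in
/-- **THE STEP MOVES THE SIZES BY `≤ 300dM·Df(u)`** on the region (`S ≤ 10⁻⁴`, `6dM·δmax ≤ 10⁻⁴`, `M·S ≤ τ`, `30000dτ ≤ 1`). [folklore] -/
theorem step_sizes_le (hd : 0 < d)
    (hθP : 4 * (d : ℝ) ^ 2 * ((L : ℝ) ^ (k + 1) - 1) ^ 2 * x + 16 * d * loopRad d L ((prop1Radius d L)^[k] x)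
      + 4 * d * ((d : ℝ) - 1) * ((L : ℝ) ^ (k + 1) - 1) ^ 2 * x ≤ 1 / 2)
    {τ S δmax : ℝ} (hτs : 30000 * (d : ℝ) * τ ≤ 1)
    (hS4 : S ≤ 1 / 10000) (hMS : (L : ℝ) ^ (k + 1) * S ≤ τ)
    (hδmax : 6 * (d : ℝ) * (L : ℝ) ^ (k + 1) * δmax ≤ 1 / 10000)
    {u : Site d → (Matrix n n ℂ)ˣ} (hu : IsUnitarySite u) (huP : IsPeriodicSite u ((tower L N (k + 1) : ℕ) : ℤ))
    (hgauge : gaugeAct u U' = vary W (repLog W U' u) 1)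
    (hcorner : ∀ z, ((u (((L : ℤ) ^ (k + 1)) • z) : (Matrix n n ℂ)ˣ) : Matrix n n ℂ) = exp (cornerLog L k u z))
    (hDf : sliceDefect hL k hWu hx hs hWx N hθ U' u ≤ δmax) (hΦ : ‖sizePair (L := L) (W := W) k N U' u‖ ≤ S) :
    ‖sizePair (L := L) (W := W) k N U' (sliceStep hL k hWu hx hs hWx N hθ U' u)‖
      ≤ ‖sizePair (L := L) (W := W) k N U' u‖ + 300 * d * (L : ℝ) ^ (k + 1) * sliceDefect hL k hWu hx hs hWx N hθ U' u := by
  haveI : NeZero L := ⟨by omega⟩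
  have hP1 : 1 ≤ tower L N (k + 1) := Nat.one_le_iff_ne_zero.mpr (NeZero.ne _)
  have hN1 : 1 ≤ N := Nat.one_le_iff_ne_zero.mpr (NeZero.ne _)
  have hM1 : (1 : ℝ) ≤ (L : ℝ) ^ (k + 1) := one_le_pow₀ (by exact_mod_cast (by omega : 1 ≤ L))
  have hd1 : (1 : ℝ) ≤ d := by exact_mod_cast hd
  obtain ⟨hX, hh, h10, h1le, h20, h2le⟩ := region_sizes hL k N U' hWP hU'P huP
  obtain ⟨a, hadef⟩ : ∃ a : ℝ, (sizePair (L := L) (W := W) k N U' u).1 = a := ⟨_, rfl⟩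
  obtain ⟨b, hbdef⟩ : ∃ b : ℝ, (sizePair (L := L) (W := W) k N U' u).2 = b := ⟨_, rfl⟩
  rw [hadef] at hX h10 h1le
  rw [hbdef] at hh h20 h2le
  have haS : a ≤ S := h1le.trans hΦ
  have hbS : b ≤ S := h2le.trans hΦ
  have ha4 : a ≤ 1 / 10000 := haS.trans hS4
  have hb2 : b ≤ 1 / 100 := hbS.trans (hS4.trans (by norm_num))
  have hX8 : ∀ y κ, ‖repLog W U' u y κ‖ ≤ 1 / 8 := fun y κ => (hX y κ).trans (by linarith)
  have hh8 : ∀ z, ‖cornerLog L k u z‖ ≤ 1 / 8 := fun z => (hh z).trans (by linarith)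
  have hDf0 : 0 ≤ sliceDefect hL k hWu hx hs hWx N hθ U' u := sliceDefect_nonneg hL k hWu hx hs hWx N hθ U' u
  obtain ⟨D, hDdef⟩ : ∃ D : ℝ, sliceDefect hL k hWu hx hs hWx N hθ U' u = D := ⟨_, rfl⟩
  have hD0 : 0 ≤ D := hDdef ▸ hDf0
  have hDmax : D ≤ δmax := hDdef ▸ hDf
  clear hDf hDf0
  have hδ : ∀ y μ, ‖gaugeDir W (gaugeFun hL k hWu hx hs hWx N hθ U' u) y μ‖ ≤ D := fun y μ =>
    hDdef ▸ ((norm_gaugeDir_gaugeFun_le hL k hWu hx hs hWx N hθ U' hWP hU'u hU'P hu huP hgauge hX8 hcorner hh8 y μ).trans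
      (delta_le_sliceDefect hL k hWu hx hs hWx N hθ U' u))
  have hσ : ∀ y, ‖gaugeFun hL k hWu hx hs hWx N hθ U' u y‖ ≤ 6 * d * (L : ℝ) ^ (k + 1) * D := fun y => by
    rw [← hDdef]; exact norm_gaugeFun_le hL k hWu hx hs hWx N hθ U' hWP hU'u hU'P hu huP hgauge hX8 hcorner hh8 hd hθP y
  have hσ0 : 0 ≤ 6 * (d : ℝ) * (L : ℝ) ^ (k + 1) * D := by positivity
  have hσ4 : 6 * (d : ℝ) * (L : ℝ) ^ (k + 1) * D ≤ 1 / 10000 := (mul_le_mul_of_nonneg_left hDmax (by positivity)).trans hδmax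
  -- the two components after the step
  have hX1 := norm_repLog_sliceStep_le hL k hWu hx hs hWx N hθ U' hgauge hX ha4 hδ hσ hσ4
  have hh1 := norm_cornerLog_sliceStep_le hL k hWu hx hs hWx N hθ U' hcorner hh hb2 hσ hσ4
  obtain ⟨M, hMdef⟩ : ∃ M : ℝ, (L : ℝ) ^ (k + 1) = M := ⟨_, rfl⟩
  rw [hMdef] at hM1 hMS hσ hσ0 hσ4 hX1 hh1 hδmax ⊢
  have hMa : M * a ≤ τ := (mul_le_mul_of_nonneg_left haS (by linarith)).trans hMS
  -- `e_J ≤ 2D`, `σ + 4096σb ≤ 2σ`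
  have heJ : 16384 * D * a + 2048 * (6 * (d : ℝ) * M * D) * D + 6 * (6 * (d : ℝ) * M * D) * a ≤ 2 * D := by
    have t1 : 16384 * D * a ≤ 16384 * D * (1 / 10000) := mul_le_mul_of_nonneg_left ha4 (by positivity)
    have t2 : (6 * (d : ℝ) * M * D) * D ≤ (1 / 10000) * D := mul_le_mul_of_nonneg_right hσ4 hD0
    have t3 : 6 * (6 * (d : ℝ) * M * D) * a = 36 * (d : ℝ) * (M * a) * D := by ring
    have t4 : 36 * (d : ℝ) * (M * a) * D ≤ 36 * (d : ℝ) * τ * D := by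
      have := mul_le_mul_of_nonneg_left hMa (by positivity : (0:ℝ) ≤ 36 * (d : ℝ) * D); linarith only [this]
    have t5 : (30000 * (d : ℝ) * τ) * D ≤ 1 * D := mul_le_mul_of_nonneg_right hτs hD0
    linarith only [t1, t2, t3, t4, t5, hD0]
  have hdMD : D ≤ (d : ℝ) * M * D := by
    have : (1 : ℝ) ≤ (d : ℝ) * M := by nlinarith only [hd1, hM1]
    exact le_mul_of_one_le_left hD0 this
  have hcomp1 : ∀ y κ, ‖repLog W U' (sliceStep hL k hWu hx hs hWx N hθ U' u) y κ‖ ≤ a + 300 * d * M * D := fun y κ => by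
    have := hX1 y κ
    linarith only [this, heJ, hdMD, hD0]
  have hcomp2 : ∀ z, ‖cornerLog L k (sliceStep hL k hWu hx hs hWx N hθ U' u) z‖ ≤ b + 300 * d * M * D := fun z => by
    have := hh1 z
    have t : 4096 * (6 * (d : ℝ) * M * D) * b ≤ (6 * (d : ℝ) * M * D) * (4096 * (1 / 100)) := by
      have := mul_le_mul_of_nonneg_left hb2 hσ0; linarith only [this]
    linarith only [this, t, hσ0, hdMD, hD0]
  have hfst : (sizePair (L := L) (W := W) k N U' (sliceStep hL k hWu hx hs hWx N hθ U' u)).1 ≤ a + 300 * d * M * D :=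
    bondSup_le hP1 (by positivity) hcomp1
  have hsnd : (sizePair (L := L) (W := W) k N U' (sliceStep hL k hWu hx hs hWx N hθ U' u)).2 ≤ b + 300 * d * M * D :=
    siteSup_le hN1 hcomp2
  have hfst0 : 0 ≤ (sizePair (L := L) (W := W) k N U' (sliceStep hL k hWu hx hs hWx N hθ U' u)).1 := bondSup_nonneg fun y μ => norm_nonneg _
  have hsnd0 : 0 ≤ (sizePair (L := L) (W := W) k N U' (sliceStep hL k hWu hx hs hWx N hθ U' u)).2 := siteSup_nonneg fun z => norm_nonneg _
  rw [← hDdef] at hfst hsnd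
  rw [Prod.norm_def, Real.norm_of_nonneg hfst0, Real.norm_of_nonneg hsnd0]
  exact max_le (by linarith) (by linarith)

/-! ## §2 The orbit and its limit -/

include hWP hU'u hU'P in
/-- **THE (S1) ORBIT CONVERGES**: in the regime of the header, from a state `u₀` on the working region with `‖sizePair u₀‖ ≤ s₀`, `Df(u₀) ≤ δ₀ ≤ δmax` and `s₀ + 600dM·δ₀ ≤ S`, the orbit
`u_j := sliceStep^[j] u₀` stays on the region, `Df(u_j) ≤ 2^{−j}δ₀`, `‖sizePair u_j‖ ≤ s₀ + 600dM·δ₀`, and converges sitewise to a unitary `(tower)`-periodic `u⋆` with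
`‖u_j(y) − u⋆(y)‖ ≤ 12dM·δ₀·2^{−j}∕(1 − 1∕2)`. [folklore] -/
theorem slice_orbit (hd : 0 < d)
    (hθP : 4 * (d : ℝ) ^ 2 * ((L : ℝ) ^ (k + 1) - 1) ^ 2 * x + 16 * d * loopRad d L ((prop1Radius d L)^[k] x)
      + 4 * d * ((d : ℝ) - 1) * ((L : ℝ) ^ (k + 1) - 1) ^ 2 * x ≤ 1 / 2)
    {K : ℝ} (hK : 0 ≤ K) (hKε : 16 * K * d * (((L : ℝ) ^ (k + 1)) ^ 2 * x) ≤ 1 / 2)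
    (hLet : ∀ Y : Site d → Fin d → Matrix n n ℂ, Y ∈ energyBlockLandauW (d := d) (n := n) L N (k + 1) W →
      ∀ B : ℝ, (∀ (z : Site d) (μ ν : Fin d), μ ≠ ν → ‖curlAt W Y z μ ν‖ ≤ B) → ∀ (y : Site d) (κ : Fin d), ‖Y y κ‖ ≤ K * (L : ℝ) ^ (k + 1) * B)
    (hε : ((L : ℝ) ^ (k + 1)) ^ 2 * x ≤ 1) (hA : curvSum d L (k + 1) x ≤ 2 / 3 * L) (hθc : cruxC d L * (((L : ℝ) ^ (k + 1)) ^ 2 * x) ≤ 1 / 2)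
    {x' : ℝ} (hx'0 : 0 ≤ x') (hU'x : SmallField U' x')
    {τ S δmax : ℝ} (hτ0 : 0 ≤ τ) (hτ1 : τ ≤ 1) (hτs : 30000 * (d : ℝ) * τ ≤ 1)
    (hC : 3000000 * (1 + 16 * K) * (1 + (d : ℝ)) ^ 3 * (1 + frameC d L) * (1 + supC d L + supCurlC d L) * τ ≤ 1 / 2)
    (hS0 : 0 ≤ S) (hS4 : S ≤ 1 / 10000) (hMS : (L : ℝ) ^ (k + 1) * S ≤ τ) (hSτ : S ≤ τ)
    (hδmax : 6 * (d : ℝ) * (L : ℝ) ^ (k + 1) * δmax ≤ 1 / 10000) (hMδ : (L : ℝ) ^ (k + 1) * δmax ≤ τ)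
    (h4 : ((L : ℝ) ^ (k + 1)) ^ 2 * x ≤ τ) (h5 : ((L : ℝ) ^ (k + 1)) ^ 2 * x' ≤ τ)
    {u₀ : Site d → (Matrix n n ℂ)ˣ} (hu₀ : IsUnitarySite u₀) (hu₀P : IsPeriodicSite u₀ ((tower L N (k + 1) : ℕ) : ℤ))
    (hgauge₀ : gaugeAct u₀ U' = vary W (repLog W U' u₀) 1)
    (hcorner₀ : ∀ z, ((u₀ (((L : ℤ) ^ (k + 1)) • z) : (Matrix n n ℂ)ˣ) : Matrix n n ℂ) = exp (cornerLog L k u₀ z))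
    {s₀ δ₀ : ℝ} (hδ₀ : 0 ≤ δ₀) (hδ₀max : δ₀ ≤ δmax) (hs₀ : ‖sizePair (L := L) (W := W) k N U' u₀‖ ≤ s₀) (hd₀ : sliceDefect hL k hWu hx hs hWx N hθ U' u₀ ≤ δ₀)
    (hSsum : s₀ + 300 * d * (L : ℝ) ^ (k + 1) * δ₀ / (1 - 1 / 2) ≤ S) :
    ∃ ustar : Site d → (Matrix n n ℂ)ˣ, IsUnitarySite ustar ∧ IsPeriodicSite ustar ((tower L N (k + 1) : ℕ) : ℤ) ∧
      (∀ y, Tendsto (fun j => (((sliceStep hL k hWu hx hs hWx N hθ U')^[j] u₀ y : (Matrix n n ℂ)ˣ) : Matrix n n ℂ)) atTop (𝓝 ((ustar y : (Matrix n n ℂ)ˣ) : Matrix n n ℂ))) ∧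
      (∀ (y : Site d) (j : ℕ), ‖(((sliceStep hL k hWu hx hs hWx N hθ U')^[j] u₀ y : (Matrix n n ℂ)ˣ) : Matrix n n ℂ) - ((ustar y : (Matrix n n ℂ)ˣ) : Matrix n n ℂ)‖
        ≤ 12 * d * (L : ℝ) ^ (k + 1) * δ₀ * (1 / 2) ^ j / (1 - 1 / 2)) ∧
      ∀ j, (IsUnitarySite ((sliceStep hL k hWu hx hs hWx N hθ U')^[j] u₀) ∧ IsPeriodicSite ((sliceStep hL k hWu hx hs hWx N hθ U')^[j] u₀) ((tower L N (k + 1) : ℕ) : ℤ) ∧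
          gaugeAct ((sliceStep hL k hWu hx hs hWx N hθ U')^[j] u₀) U' = vary W (repLog W U' ((sliceStep hL k hWu hx hs hWx N hθ U')^[j] u₀)) 1 ∧
          (∀ z, ((((sliceStep hL k hWu hx hs hWx N hθ U')^[j] u₀) (((L : ℤ) ^ (k + 1)) • z) : (Matrix n n ℂ)ˣ) : Matrix n n ℂ)
            = exp (cornerLog L k ((sliceStep hL k hWu hx hs hWx N hθ U')^[j] u₀) z)) ∧
          sliceDefect hL k hWu hx hs hWx N hθ U' ((sliceStep hL k hWu hx hs hWx N hθ U')^[j] u₀) ≤ δmax) ∧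
        sliceDefect hL k hWu hx hs hWx N hθ U' ((sliceStep hL k hWu hx hs hWx N hθ U')^[j] u₀) ≤ (1 / 2) ^ j * δ₀ ∧
        ‖sizePair (L := L) (W := W) k N U' ((sliceStep hL k hWu hx hs hWx N hθ U')^[j] u₀)‖ ≤ s₀ + 300 * d * (L : ℝ) ^ (k + 1) * δ₀ / (1 - 1 / 2) := by
  have hM0 : 0 < (L : ℝ) ^ (k + 1) := by positivity
  have hS2 : S ≤ 1 / 100 := hS4.trans (by norm_num)
  -- the region data of a state
  have hreg : ∀ u : Site d → (Matrix n n ℂ)ˣ, IsPeriodicSite u ((tower L N (k + 1) : ℕ) : ℤ) → ‖sizePair (L := L) (W := W) k N U' u‖ ≤ S →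
      (∀ y κ, ‖repLog W U' u y κ‖ ≤ S) ∧ (∀ z, ‖cornerLog L k u z‖ ≤ S) := fun u huP hΦ => by
    obtain ⟨hX, hh, -, h1le, -, h2le⟩ := region_sizes hL k N U' hWP hU'P huP
    exact ⟨fun y κ => (hX y κ).trans (h1le.trans hΦ), fun z => (hh z).trans (h2le.trans hΦ)⟩
  have hgf : ∀ u : Site d → (Matrix n n ℂ)ˣ, IsUnitarySite u → IsPeriodicSite u ((tower L N (k + 1) : ℕ) : ℤ) → gaugeAct u U' = vary W (repLog W U' u) 1 →
      (∀ z, ((u (((L : ℤ) ^ (k + 1)) • z) : (Matrix n n ℂ)ˣ) : Matrix n n ℂ) = exp (cornerLog L k u z)) → sliceDefect hL k hWu hx hs hWx N hθ U' u ≤ δmax →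
      ‖sizePair (L := L) (W := W) k N U' u‖ ≤ S →
      (∀ y, ‖gaugeFun hL k hWu hx hs hWx N hθ U' u y‖ ≤ 6 * d * (L : ℝ) ^ (k + 1) * sliceDefect hL k hWu hx hs hWx N hθ U' u) ∧
        6 * (d : ℝ) * (L : ℝ) ^ (k + 1) * sliceDefect hL k hWu hx hs hWx N hθ U' u ≤ 1 / 10000 := fun u hu huP hgauge hcorner hDf hΦ => by
    obtain ⟨hXs, hhs⟩ := hreg u huP hΦ
    have hX8 : ∀ y κ, ‖repLog W U' u y κ‖ ≤ 1 / 8 := fun y κ => (hXs y κ).trans (by linarith)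
    have hh8 : ∀ z, ‖cornerLog L k u z‖ ≤ 1 / 8 := fun z => (hhs z).trans (by linarith)
    exact ⟨norm_gaugeFun_le hL k hWu hx hs hWx N hθ U' hWP hU'u hU'P hu huP hgauge hX8 hcorner hh8 hd hθP,
      (mul_le_mul_of_nonneg_left hDf (by positivity)).trans hδmax⟩
  -- the four engine hypotheses
  have hmaps : ∀ u ∈ {u : Site d → (Matrix n n ℂ)ˣ | IsUnitarySite u ∧ IsPeriodicSite u ((tower L N (k + 1) : ℕ) : ℤ) ∧ gaugeAct u U' = vary W (repLog W U' u) 1 ∧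
      (∀ z, ((u (((L : ℤ) ^ (k + 1)) • z) : (Matrix n n ℂ)ˣ) : Matrix n n ℂ) = exp (cornerLog L k u z)) ∧ sliceDefect hL k hWu hx hs hWx N hθ U' u ≤ δmax},
      ‖sizePair (L := L) (W := W) k N U' u‖ ≤ S →
      sliceStep hL k hWu hx hs hWx N hθ U' u ∈ {u : Site d → (Matrix n n ℂ)ˣ | IsUnitarySite u ∧ IsPeriodicSite u ((tower L N (k + 1) : ℕ) : ℤ) ∧
        gaugeAct u U' = vary W (repLog W U' u) 1 ∧ (∀ z, ((u (((L : ℤ) ^ (k + 1)) • z) : (Matrix n n ℂ)ˣ) : Matrix n n ℂ) = exp (cornerLog L k u z)) ∧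
        sliceDefect hL k hWu hx hs hWx N hθ U' u ≤ δmax} := by
    rintro u ⟨hu, huP, hgauge, hcorner, hDf⟩ hΦ
    obtain ⟨hXs, hhs⟩ := hreg u huP hΦ
    obtain ⟨hσ, hσ4⟩ := hgf u hu huP hgauge hcorner hDf hΦ
    have hhalf := step_halves_defect hL k hWu hx hs hWx N hθ U' hWP hU'u hU'P hd hθP hK hKε hLet hε hA hθc hx'0 hU'x hτ0 hτ1 hτs hC hS0 hS4 hMS hSτ hδmax hMδ h4 h5
      hu huP hgauge hcorner hDf hΦ
    have hDf0 := sliceDefect_nonneg hL k hWu hx hs hWx N hθ U' u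
    exact ⟨sliceStep_unitary hL k hWu hx hs hWx N hθ U' hWP hU'u hU'P hu huP hgauge hcorner hXs hS4 hhs hS2,
      sliceStep_periodic hL k hWu hx hs hWx N hθ U' hWP hU'u hU'P hu huP hgauge hcorner hXs hS4 hhs hS2,
      sliceStep_chart hL k hWu hx hs hWx N hθ U' hgauge hXs hS4 hσ hσ4,
      sliceStep_corner hL k hWu hx hs hWx N hθ U' hcorner hhs hS2 hσ hσ4,
      hhalf.trans (by linarith)⟩
  have hcontr : ∀ u ∈ {u : Site d → (Matrix n n ℂ)ˣ | IsUnitarySite u ∧ IsPeriodicSite u ((tower L N (k + 1) : ℕ) : ℤ) ∧ gaugeAct u U' = vary W (repLog W U' u) 1 ∧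
      (∀ z, ((u (((L : ℤ) ^ (k + 1)) • z) : (Matrix n n ℂ)ˣ) : Matrix n n ℂ) = exp (cornerLog L k u z)) ∧ sliceDefect hL k hWu hx hs hWx N hθ U' u ≤ δmax},
      ‖sizePair (L := L) (W := W) k N U' u‖ ≤ S →
      sliceDefect hL k hWu hx hs hWx N hθ U' (sliceStep hL k hWu hx hs hWx N hθ U' u) ≤ 1 / 2 * sliceDefect hL k hWu hx hs hWx N hθ U' u := by
    rintro u ⟨hu, huP, hgauge, hcorner, hDf⟩ hΦ
    have hhalf := step_halves_defect hL k hWu hx hs hWx N hθ U' hWP hU'u hU'P hd hθP hK hKε hLet hε hA hθc hx'0 hU'x hτ0 hτ1 hτs hC hS0 hS4 hMS hSτ hδmax hMδ h4 h5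
      hu huP hgauge hcorner hDf hΦ
    linarith
  have hgrow : ∀ u ∈ {u : Site d → (Matrix n n ℂ)ˣ | IsUnitarySite u ∧ IsPeriodicSite u ((tower L N (k + 1) : ℕ) : ℤ) ∧ gaugeAct u U' = vary W (repLog W U' u) 1 ∧
      (∀ z, ((u (((L : ℤ) ^ (k + 1)) • z) : (Matrix n n ℂ)ˣ) : Matrix n n ℂ) = exp (cornerLog L k u z)) ∧ sliceDefect hL k hWu hx hs hWx N hθ U' u ≤ δmax},
      ‖sizePair (L := L) (W := W) k N U' u‖ ≤ S →
      ‖sizePair (L := L) (W := W) k N U' (sliceStep hL k hWu hx hs hWx N hθ U' u)‖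
        ≤ ‖sizePair (L := L) (W := W) k N U' u‖ + 300 * d * (L : ℝ) ^ (k + 1) * sliceDefect hL k hWu hx hs hWx N hθ U' u := by
    rintro u ⟨hu, huP, hgauge, hcorner, hDf⟩ hΦ
    exact step_sizes_le hL k hWu hx hs hWx N hθ U' hWP hU'u hU'P hd hθP hτs hS4 hMS hδmax hu huP hgauge hcorner hDf hΦ
  have hdisp : ∀ u ∈ {u : Site d → (Matrix n n ℂ)ˣ | IsUnitarySite u ∧ IsPeriodicSite u ((tower L N (k + 1) : ℕ) : ℤ) ∧ gaugeAct u U' = vary W (repLog W U' u) 1 ∧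
      (∀ z, ((u (((L : ℤ) ^ (k + 1)) • z) : (Matrix n n ℂ)ˣ) : Matrix n n ℂ) = exp (cornerLog L k u z)) ∧ sliceDefect hL k hWu hx hs hWx N hθ U' u ≤ δmax},
      ‖sizePair (L := L) (W := W) k N U' u‖ ≤ S →
      ∀ y : Site d, ‖((sliceStep hL k hWu hx hs hWx N hθ U' u y : (Matrix n n ℂ)ˣ) : Matrix n n ℂ) - ((u y : (Matrix n n ℂ)ˣ) : Matrix n n ℂ)‖
        ≤ 12 * d * (L : ℝ) ^ (k + 1) * sliceDefect hL k hWu hx hs hWx N hθ U' u := by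
    rintro u ⟨hu, huP, hgauge, hcorner, hDf⟩ hΦ y
    obtain ⟨hσ, hσ4⟩ := hgf u hu huP hgauge hcorner hDf hΦ
    have h := norm_sliceStep_sub_le hL k hWu hx hs hWx N hθ U' hu hσ hσ4 y
    linarith
  obtain ⟨v, hv, htail, horbit⟩ := exists_orbit_limit
    (K := {u : Site d → (Matrix n n ℂ)ˣ | IsUnitarySite u ∧ IsPeriodicSite u ((tower L N (k + 1) : ℕ) : ℤ) ∧ gaugeAct u U' = vary W (repLog W U' u) 1 ∧
      (∀ z, ((u (((L : ℤ) ^ (k + 1)) • z) : (Matrix n n ℂ)ˣ) : Matrix n n ℂ) = exp (cornerLog L k u z)) ∧ sliceDefect hL k hWu hx hs hWx N hθ U' u ≤ δmax})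
    (step := sliceStep hL k hWu hx hs hWx N hθ U') (Φ := fun u => sizePair (L := L) (W := W) k N U' u) (Df := sliceDefect hL k hWu hx hs hWx N hθ U')
    (ev := fun (u : Site d → (Matrix n n ℂ)ˣ) (y : Site d) => ((u y : (Matrix n n ℂ)ˣ) : Matrix n n ℂ))
    (θ := 1 / 2) (A := 300 * d * (L : ℝ) ^ (k + 1)) (B := 12 * d * (L : ℝ) ^ (k + 1)) (S := S) (s₀ := s₀) (δ₀ := δ₀) (u₀ := u₀)
    (by norm_num) (by norm_num) (by positivity) hδ₀ hSsum hmaps hcontr hgrow (by positivity) hdisp ⟨hu₀, hu₀P, hgauge₀, hcorner₀, hd₀.trans hδ₀max⟩ hs₀ hd₀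
  have hvu : ∀ y, v y ∈ unitary (Matrix n n ℂ) := mem_unitary_of_tendsto (fun j => (horbit j).1.1) hv
  refine ⟨fun y => Unitary.toUnits ⟨v y, hvu y⟩, fun y => mem_unitaryUnits.mpr (hvu y), fun y i => ?_, fun y => hv y, fun y j => ?_,
    fun j => ⟨(horbit j).1, (horbit j).2.1, (horbit j).2.2⟩⟩
  · exact Units.ext (periodic_of_tendsto (fun j => (horbit j).1.2.1) hv y i)
  · have h := htail y j
    rwa [dist_eq_norm] at h

end Orbit

end

end Summit.QuantumFields.BalabanUV.T4Continuum.NE7SliceIterationOrbit
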